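import Literature.MathematicalPhysics.QuantumFieldTheory.Balaban1983to89.B4StripSums
import HarnessLib

/-!
# NE7K1LinStripClass — row NE7 (node U5), candidate route HOM, path H1L, cell K1-lin(s): NEEDS-ESTIMATE #E1, R-E1 TRANCHE A —
# THE SYMBOL CLASS `S` OF THE STRIP ENGINE AND THE REGROUPED DENOMINATOR OVER IT (b04's `B4Strip` RE-TYPED over a general
# Laplacian-type symbol `σ` in place of `Δ^ξ_n + m²`)

Lineage `b2b-balaban-t4-ne7-p2` (CRUX PROVER NE7 #2), generation 76; file 62.  The cell's open item #E1 = R-E1 (PRICING-NE7 v34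
§248 (d): «the class-S re-typing of the strip engine for the s-family `σ_s = n²[(1−s)Δ¹ + s·k_L]` with constants uniform in s,
in the mesh n and in the torus»).  b04's engine (`B4Strip`, `B4StripCauchy`, `B4StripSums`) is typed for ONE symbol, the block
Laplacian `DeltaXi n m² = Σ_μ S_ξ + m²`; lens 2's census (E-57, PRICING v29 §216 (a), reproduced by the desk F151) lists every property
of that symbol the engine CONSUMES: (a′) real-part floors of the SHIFTED symbol off `k = 0`, (b′) `Re > 0` on the zone edges,
(c′) a modulus upper bound on the fat region, (d′) the real sign, (e′) holomorphy + the `2π` law.  THIS FILE types the class and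
re-derives b04's `B4Strip` layer over it ([folklore]; b04's one-coordinate lemmas BY NAME):

* §1 **`SymbS n σ r C_S C_up`** (a `Prop` structure): at mesh `n`, a symbol `σ : ℂ^d → ℂ` with (S1) `2πn`-periodicity in every
  coordinate, (S2) joint holomorphy on the closed tube `|Im q_ν| ≤ 2r`, (S3) reality on real momenta, (S4) THE FLOOR
  `Re σ(x + iη) ≥ Δ^ξ_n(x) − C_S·Σ_ν η_ν²` for ALL real `x` and `|η_ν| ≤ 2r` (b04's `re_Sxi_ge` shape, summed), (S5) `‖σ‖ ≤ C_up` on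
  b04's fat region `Fat d r`, and the admissibility of the constants `0 < r ≤ 1∕4`, `0 ≤ C_S`, `16·C_S·d·r² ≤ 1`.
  Lens 2's (a′), (b′), (d′) are NOT assumed — they are THEOREMS of (S4) (§4–§5).
* §2 **`ES n σ a`** — the regrouped denominator `σ(p) + a·U₀(p) + a·Σ_{k≠0} U_k(p)·σ(p)∕σ(p + 2πk)` with b04's averaging weights
  `U` UNCHANGED (the averaging operator is the same; only the Laplacian symbol moves), and **`E_eq_ES : E n a m² = ES n (Δ^ξ_n + m²) a`**
  (`rfl`) — b04's denominator IS the class instance.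
* §3 reality: `σ(s) = reS σ s ∈ ℝ`, `reS σ s ≥ Δ^ξ_n(s) ≥ 0`; `ES` is real on real momenta (`ES_ofReal`) and REAL POSITIVITY
  **`ESr_ge ∕ ES_re_ge`**: `a(4∕π²)^d ≤ ‖ES n σ a s‖` on the Brillouin zone, every `n ≥ 1`, `a ≥ 0` (b04's `Er_ge` verbatim over S).
* §4 (a′) DERIVED: on `Fat d r`, `k ≠ 0`: **`two_le_re_shift`** `2 ≤ Re σ(q + 2πk)`, **`W_le_re_shift`** `¼·W_n(k) ≤ Re σ(q + 2πk)`
  (b04's `shifted_sin_sq_ge` per coordinate + (S4) + `16C_Sdr² ≤ 1`), `shift_ne_zero`, `two_le_norm_shift`.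
* §5 (b′) DERIVED: **`re_pos_of_edge`** — `Re σ(q) > 0` at a tube point `|Im q_ν| ≤ 2r` with some `|Re q_μ| = π`
  (`B5Strip145Analytic.four_le_scaled_sin_sq` + (S4)).
* §6 (c′) USED: **`norm_ES_le`** `‖ES n σ a q‖ ≤ boundMS d |a| C_up = C_up + |a|4^d + |a|(C_up∕2)132^d` on `Fat d r`
  (b04's `norm_U_zero_le ∕ sum_norm_U_le` BY NAME).
* §7 (e′) USED: **`differentiableAt_ES`** (joint) and **`differentiableAt_ES_slice`** on `Fat d r`
  (`B5Strip145Analytic.differentiableAt_U` BY NAME, (S2) at `q` and at `q + 2πk`, §4's non-vanishing).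

The Cauchy step (`imLipschitz_of_fat` ⇒ the uniform zero-free strip of `ES`, constants in `(d, a₋, a₊, r, C_S, C_up)` only) is
file 63; the instances `Δ^ξ_n + m² ∈ S` and `σ_s^{(n)} = (1−s)Δ^ξ_n + s·n²·kLfold(·∕n) ∈ S` (every `s ∈ [0,1]`, `n ≥ 1`, constants
in `d` alone) are files 64–65; `B4StripSums` over S is tranche C.

HONEST FRAMING: [folklore] bookkeeping over b04's own lemmas; a DEFINITION of a hypothesis class and the algebra of the regrouped
denominator over it; no symbol is asserted to be in the class here; nothing of Bałaban's asserted; no `sorry`.  Census only; NE7 NOT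
PRINTED ∕ NOT PROVED; spine 0∕9; FIXED FINITE T⁴, rung (B)+1; NOT infinite volume, NOT mass gap, NOT Clay.  HONEST DEPENDENCY:
continuum YM on T⁴ ⇐ BetaPertH ∧ nine spine estimates (0/9 proved); BetaPertH ⇐ (D1) ∧ (D4) ∧ CAP+tail; G-an2-4 gates asym, D1 and
NE2/3/4.
-/

noncomputable section

open Finset Complex Set

namespace Summit.QuantumFields.BalabanUV.T4Continuum.NE7K1LinStripClass

open Literature.MathematicalPhysics.QuantumFieldTheory.Balaban1983to89
open Literature.MathematicalPhysics.QuantumFieldTheory.Balaban1983to89.B4Strip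
open Literature.MathematicalPhysics.QuantumFieldTheory.Balaban1983to89.B4StripCauchy
open Literature.MathematicalPhysics.QuantumFieldTheory.Balaban1983to89.B4StripSums
open Literature.MathematicalPhysics.QuantumFieldTheory.Balaban1983to89.B5Strip145Analytic

variable {d : ℕ}

/-! ### §1 The class `S` -/

/-- the imaginary parts of a complex momentum vector. [folklore] -/
def imVec (p : Fin d → ℂ) : Fin d → ℝ := fun μ => (p μ).im

/-- the complex momentum `x + iη` with real and imaginary parts `x, η`. [folklore] -/
def cpt (x η : Fin d → ℝ) : Fin d → ℂ := fun μ => (x μ : ℂ) + (η μ : ℂ) * I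

/-- THE SYMBOL CLASS `S` at mesh `n` with constants `(r, C_S, C_up)`: a Laplacian-type Fourier symbol `σ` on `ℂ^d` that is
(S1) `2πn`-periodic in every coordinate, (S2) holomorphic on the closed tube `|Im q_ν| ≤ 2r`, (S3) real on real momenta,
(S4) bounded below in real part by b04's real block-Laplacian symbol up to a quadratic imaginary error,
`Re σ(x + iη) ≥ Δ^ξ_n(x) − C_S Σ_ν η_ν²`, and (S5) bounded by `C_up` on the fat region `Fat d r`; with admissible constants
`0 < r ≤ 1∕4`, `0 ≤ C_S`, `16·C_S·d·r² ≤ 1` (the analogue of b04's `d r² ≤ 1∕16` at `C_S = 25∕16`).  Lens 2's consumed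
clauses (a′)–(e′) of the strip engine all follow (§3–§7).  HYPOTHESIS SHAPE — a definition; asserted of no symbol in this
file (the instances are files 64–65). [folklore] -/
@[folklore]
structure SymbS (n : ℕ) (σ : (Fin d → ℂ) → ℂ) (r CS Cup : ℝ) : Prop where
  r_pos : 0 < r
  r_le : r ≤ 1 / 4
  cs_nonneg : 0 ≤ CS
  small : 16 * CS * ((d : ℝ) * r ^ 2) ≤ 1
  periodic : ∀ (q : Fin d → ℂ) (μ : Fin d), σ (Function.update q μ (q μ + 2 * Real.pi * n)) = σ q
  holo : ∀ q : Fin d → ℂ, (∀ ν, |(q ν).im| ≤ 2 * r) → DifferentiableAt ℂ σ q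
  real : ∀ s : Fin d → ℝ, (σ (ofRealVec s)).im = 0
  floor : ∀ x η : Fin d → ℝ, (∀ ν, |η ν| ≤ 2 * r) →
    DeltaXir n 0 x - CS * ∑ ν, η ν ^ 2 ≤ (σ (cpt x η)).re
  upper : ∀ q ∈ Fat d r, ‖σ q‖ ≤ Cup

/-! ### §2 The regrouped denominator over the class -/

/-- THE REGROUPED DENOMINATOR OVER A GENERAL SYMBOL: `E_σ(p) = σ(p) + a·U₀(p) + a·Σ_{k≠0} U_k(p)·σ(p)∕σ(p + 2πk)` — b04's
`B4Strip.E` with `Δ^ξ_n + m²` replaced by `σ` (the averaging weights `U_k` of (2.45)–(2.48) are unchanged).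
[cite: Balaban1983RegularityDecay, (2.46)–(2.48) p.584–585 (regrouped by the audit; symbol generalised)] -/
def ES (n : ℕ) [NeZero n] (σ : (Fin d → ℂ) → ℂ) (a : ℝ) (p : Fin d → ℂ) : ℂ :=
  σ p + a * U n (fun _ => (0 : Fin n)) p
    + a * ∑ k ∈ (Finset.univ.erase (fun _ => (0 : Fin n))), U n k p * (σ p / σ (shift n k p))

/-- b04's regrouped denominator IS the class denominator at the block-Laplacian symbol: `E n a m² = ES n (Δ^ξ_n + m²) a`. [folklore] -/
theorem E_eq_ES (n : ℕ) [NeZero n] (a m2 : ℝ) (p : Fin d → ℂ) : E n a m2 p = ES n (DeltaXi n m2) a p := rfl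

/-- the real part of the symbol on real momenta. [folklore] -/
def reS (σ : (Fin d → ℂ) → ℂ) (s : Fin d → ℝ) : ℝ := (σ (ofRealVec s)).re

/-- the real form of `ES`. [folklore] -/
def ESr (n : ℕ) [NeZero n] (σ : (Fin d → ℂ) → ℂ) (a : ℝ) (s : Fin d → ℝ) : ℝ :=
  reS σ s + a * Ur n (fun _ => (0 : Fin n)) s
    + a * ∑ k ∈ (Finset.univ.erase (fun _ => (0 : Fin n))), Ur n k s * (reS σ s / reS σ (shiftr n k s))

/-! ### §3 Reality and real positivity -/

/-- `x + i·0 = x`. [folklore] -/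
theorem cpt_zero (x : Fin d → ℝ) : cpt x (fun _ => 0) = ofRealVec x := by
  funext μ; simp [cpt, ofRealVec]

/-- `Re q + i Im q = q`. [folklore] -/
theorem cpt_reVec_imVec (q : Fin d → ℂ) : cpt (reVec q) (imVec q) = q := by
  funext μ; simp [cpt, reVec, imVec, Complex.re_add_im]

/-- `q + 2πk = (Re q + 2πk) + i Im q`. [folklore] -/
theorem shift_eq_cpt (n : ℕ) (k : Fin d → Fin n) (q : Fin d → ℂ) :
    shift n k q = cpt (shiftr n k (reVec q)) (imVec q) := by
  funext μ
  apply Complex.ext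
  · simp [shift, shiftr, cpt, reVec, imVec]
  · simp [shift, shiftr, cpt, reVec, imVec]

variable {n : ℕ} {σ : (Fin d → ℂ) → ℂ} {r CS Cup : ℝ}

/-- a class symbol is real on real momenta. [folklore] -/
theorem SymbS.ofReal (h : SymbS n σ r CS Cup) (s : Fin d → ℝ) : σ (ofRealVec s) = ((reS σ s : ℝ) : ℂ) := by
  apply Complex.ext
  · simp [reS]
  · simp [reS, h.real s]

/-- (d′) DERIVED: on real momenta a class symbol dominates the real block-Laplacian symbol, `Δ^ξ_n(x) ≤ σ(x)`. [folklore] -/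
theorem SymbS.DeltaXir_le_reS (h : SymbS n σ r CS Cup) (x : Fin d → ℝ) : DeltaXir n 0 x ≤ reS σ x := by
  have h0 : ∀ ν : Fin d, |(fun _ : Fin d => (0 : ℝ)) ν| ≤ 2 * r := fun ν => by
    simp only [abs_zero]; linarith [h.r_pos]
  have := h.floor x (fun _ => 0) h0
  simp only [cpt_zero] at this
  simpa [reS] using this

/-- (d′) DERIVED: a class symbol is `≥ 0` on real momenta. [folklore] -/
theorem SymbS.reS_nonneg (h : SymbS n σ r CS Cup) (x : Fin d → ℝ) : 0 ≤ reS σ x :=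
  (DeltaXir_nonneg n 0 le_rfl x).trans (h.DeltaXir_le_reS x)

/-- `ES` is the real number `ESr` on real momenta. [folklore] -/
theorem SymbS.ES_ofReal [NeZero n] (h : SymbS n σ r CS Cup) (a : ℝ) (s : Fin d → ℝ) :
    ES n σ a (ofRealVec s) = ((ESr n σ a s : ℝ) : ℂ) := by
  unfold ES ESr
  simp only [U_ofReal, shift_ofReal, h.ofReal]
  push_cast; rfl

/-- REAL POSITIVITY over the class: `ESr ≥ a(4∕π²)^d` on the Brillouin zone, every `n ≥ 1`, `a ≥ 0` (b04's `Er_ge` with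
`Δ^ξ_n + m² ≥ 0` replaced by `σ ≥ 0`; the floor `U₀ ≥ (2∕π)^{2d}` is the averaging weight's, unchanged). [folklore] -/
theorem SymbS.ESr_ge [NeZero n] (h : SymbS n σ r CS Cup) (hn : 1 ≤ n) {a : ℝ} (ha : 0 ≤ a)
    (s : Fin d → ℝ) (hs : ∀ μ, |s μ| ≤ Real.pi) : a * (4 / Real.pi ^ 2) ^ d ≤ ESr n σ a s := by
  unfold ESr
  have h1 := h.reS_nonneg s
  have h2 := Ur_zero_ge n hn s hs
  have h3 : 0 ≤ ∑ k ∈ (Finset.univ.erase (fun _ => (0 : Fin n))),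
        Ur n k s * (reS σ s / reS σ (shiftr n k s)) := by
    apply Finset.sum_nonneg; intro k _
    exact mul_nonneg (Ur_nonneg _ _ _) (div_nonneg h1 (h.reS_nonneg _))
  have h4 : a * (4 / Real.pi ^ 2) ^ d ≤ a * Ur n (fun _ => (0 : Fin n)) s := mul_le_mul_of_nonneg_left h2 ha
  nlinarith [mul_nonneg ha h3]

/-- real positivity in modulus form: `‖ES(s)‖ ≥ a(4∕π²)^d` on the Brillouin zone. [folklore] -/
theorem SymbS.ES_re_ge [NeZero n] (h : SymbS n σ r CS Cup) (hn : 1 ≤ n) {a : ℝ} (ha : 0 ≤ a)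
    (s : Fin d → ℝ) (hs : ∀ μ, |s μ| ≤ Real.pi) : a * (4 / Real.pi ^ 2) ^ d ≤ ‖ES n σ a (ofRealVec s)‖ := by
  rw [h.ES_ofReal, Complex.norm_real]
  exact (h.ESr_ge hn ha s hs).trans (le_abs_self _)

/-! ### §4 (a′) derived: the shifted floors on the fat region -/

/-- the floor at a shifted fat point: `Re σ(q + 2πk) ≥ Δ^ξ_n(Re q + 2πk) − C_S Σ_ν (Im q_ν)²`. [folklore] -/
theorem SymbS.re_shift_ge_floor (h : SymbS n σ r CS Cup) {q : Fin d → ℂ} (hq : q ∈ Fat d r) (k : Fin d → Fin n) :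
    DeltaXir n 0 (shiftr n k (reVec q)) - CS * ∑ ν, (q ν).im ^ 2 ≤ (σ (shift n k q)).re := by
  rw [shift_eq_cpt]
  exact h.floor _ _ (fun ν => (hq ν).2)

/-- on the fat region the quadratic imaginary error is at most `1∕4`. [folklore] -/
theorem SymbS.cs_sum_im_sq_le (h : SymbS n σ r CS Cup) {q : Fin d → ℂ} (hq : ∀ ν, |(q ν).im| ≤ 2 * r) :
    CS * ∑ ν, (q ν).im ^ 2 ≤ 1 / 4 := by
  have him2 : ∑ ν, (q ν).im ^ 2 ≤ d * (2 * r) ^ 2 := by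
    calc ∑ ν, (q ν).im ^ 2 ≤ ∑ _ν : Fin d, (2 * r) ^ 2 := by
          apply Finset.sum_le_sum; intro ν _
          rw [← sq_abs]; exact pow_le_pow_left₀ (abs_nonneg _) (hq ν) 2
      _ = d * (2 * r) ^ 2 := by simp
  have h1 : CS * ∑ ν, (q ν).im ^ 2 ≤ CS * (d * (2 * r) ^ 2) := mul_le_mul_of_nonneg_left him2 h.cs_nonneg
  have h2 : CS * (d * (2 * r) ^ 2) = 16 * CS * ((d : ℝ) * r ^ 2) / 4 := by ring
  linarith [h.small]

/-- `Δ^ξ_n(x + 2πk) = Σ_ν 4n² sin²((x_ν + 2πk_ν)∕2n)`. [folklore] -/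
theorem DeltaXir_shiftr_eq (n : ℕ) (k : Fin d → Fin n) (x : Fin d → ℝ) :
    DeltaXir n 0 (shiftr n k x) = ∑ ν, 4 * (n : ℝ) ^ 2 * Real.sin ((x ν + 2 * Real.pi * (k ν : ℕ)) / (2 * n)) ^ 2 := by
  unfold DeltaXir shiftr
  rw [add_zero]
  exact Finset.sum_congr rfl (fun ν _ => Sxir_eq n _)

/-- the per-coordinate floor on the fat region: `3·[k_ν = k_{ν₀}-type] ≤ 4n² sin²(…)`, i.e. every summand is `≥ 0` and the one at a
non-zero residue is `≥ 3` and `≥ ½ω_n(k_ν)²`. [folklore] -/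
theorem shifted_summand_ge (n : ℕ) [NeZero n] {r : ℝ} (hr : r ≤ 1 / 4) {x : ℝ} (hx : |x| ≤ Real.pi + r) (j : Fin n)
    (hj : (j : ℕ) ≠ 0) :
    3 ≤ 4 * (n : ℝ) ^ 2 * Real.sin ((x + 2 * Real.pi * (j : ℕ)) / (2 * n)) ^ 2 ∧
    1 / 2 * omega n j ^ 2 ≤ 4 * (n : ℝ) ^ 2 * Real.sin ((x + 2 * Real.pi * (j : ℕ)) / (2 * n)) ^ 2 := by
  have hj1 : 1 ≤ (j : ℕ) := Nat.one_le_iff_ne_zero.mpr hj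
  have hjn : (j : ℕ) + 1 ≤ n := j.isLt
  obtain ⟨h3, hω⟩ := shifted_sin_sq_ge n j hj1 hjn hr hx
  refine ⟨h3, ?_⟩
  have hωp := omega_pos n j j.isLt
  have hω1 : omega n j ^ 2 ≤ ((j : ℕ) + 1 : ℝ) ^ 2 := pow_le_pow_left₀ hωp.le (omega_le_left n j) 2
  have hω2 : omega n j ^ 2 ≤ ((n : ℝ) - (j : ℕ)) ^ 2 := pow_le_pow_left₀ hωp.le (omega_le_right n j) 2
  rcases hω with h | h <;> linarith

/-- `Δ^ξ_n(Re q + 2πk) ≥ 3` and `≥ ½ W_n(k)` on the fat region for `k ≠ 0`. [folklore] -/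
theorem DeltaXir_shiftr_ge [NeZero n] {r : ℝ} (hr : r ≤ 1 / 4) {q : Fin d → ℂ} (hq : q ∈ Fat d r)
    (k : Fin d → Fin n) (hk : k ≠ fun _ => 0) :
    3 ≤ DeltaXir n 0 (shiftr n k (reVec q)) ∧ 1 / 2 * W n k ≤ DeltaXir n 0 (shiftr n k (reVec q)) := by
  obtain ⟨ν₀, hν₀⟩ := Function.ne_iff.mp hk
  have hk0 : ((k ν₀ : ℕ)) ≠ 0 := fun e => hν₀ (Fin.ext (by rw [e, Fin.val_zero]))
  rw [DeltaXir_shiftr_eq]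
  have hnn : ∀ ν, 0 ≤ 4 * (n : ℝ) ^ 2 * Real.sin (((reVec q) ν + 2 * Real.pi * (k ν : ℕ)) / (2 * n)) ^ 2 :=
    fun ν => by positivity
  constructor
  · have h3 := (shifted_summand_ge n hr (hq ν₀).1 (k ν₀) hk0).1
    have hsingle := Finset.single_le_sum (fun ν _ => hnn ν) (Finset.mem_univ ν₀)
    exact h3.trans hsingle
  · unfold W
    rw [Finset.mul_sum]
    apply Finset.sum_le_sum
    intro ν _
    by_cases hkν : (k ν : ℕ) = 0
    · rw [if_pos hkν, mul_zero]; exact hnn ν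
    · rw [if_neg hkν]
      exact (shifted_summand_ge n hr (hq ν).1 (k ν) hkν).2

/-- (a′) DERIVED: **`Re σ(q + 2πk) ≥ 2` on the fat region for `k ≠ 0`** — the shifted denominators of `ES` have no zero there
(b04's `re_DeltaXi_shift_ge` over the class). [folklore] -/
theorem SymbS.two_le_re_shift [NeZero n] (h : SymbS n σ r CS Cup) {q : Fin d → ℂ} (hq : q ∈ Fat d r)
    (k : Fin d → Fin n) (hk : k ≠ fun _ => 0) : 2 ≤ (σ (shift n k q)).re := by
  have h1 := h.re_shift_ge_floor hq k
  have h2 := h.cs_sum_im_sq_le (fun ν => (hq ν).2)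
  have h3 := (DeltaXir_shiftr_ge h.r_le hq k hk).1
  linarith

/-- (a′) DERIVED, quantitative: **`Re σ(q + 2πk) ≥ ¼·W_n(k)` on the fat region for `k ≠ 0`** (b04's `re_DeltaXi_shift_ge_W`
over the class, constant `7∕64 ↦ 1∕4` by the admissibility `16C_Sdr² ≤ 1`). [folklore] -/
theorem SymbS.W_le_re_shift [NeZero n] (h : SymbS n σ r CS Cup) {q : Fin d → ℂ} (hq : q ∈ Fat d r)
    (k : Fin d → Fin n) (hk : k ≠ fun _ => 0) : 1 / 4 * W n k ≤ (σ (shift n k q)).re := by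
  have h1 := h.re_shift_ge_floor hq k
  have h2 := h.cs_sum_im_sq_le (fun ν => (hq ν).2)
  have h3 := (DeltaXir_shiftr_ge h.r_le hq k hk).2
  have hW := one_le_W n k hk
  linarith

/-- `‖σ(q + 2πk)‖ ≥ 2` on the fat region for `k ≠ 0`. [folklore] -/
theorem SymbS.two_le_norm_shift [NeZero n] (h : SymbS n σ r CS Cup) {q : Fin d → ℂ} (hq : q ∈ Fat d r)
    (k : Fin d → Fin n) (hk : k ≠ fun _ => 0) : 2 ≤ ‖σ (shift n k q)‖ :=
  (h.two_le_re_shift hq k hk).trans (Complex.re_le_norm _)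

/-- the shifted symbol does not vanish on the fat region (`k ≠ 0`). [folklore] -/
theorem SymbS.shift_ne_zero [NeZero n] (h : SymbS n σ r CS Cup) {q : Fin d → ℂ} (hq : q ∈ Fat d r)
    (k : Fin d → Fin n) (hk : k ≠ fun _ => 0) : σ (shift n k q) ≠ 0 := by
  intro e
  have := h.two_le_re_shift hq k hk
  rw [e, Complex.zero_re] at this
  linarith

/-! ### §5 (b′) derived: positivity of the real part on the zone edges -/

/-- (b′) DERIVED: at a tube point (`|Im q_ν| ≤ 2r`) with one coordinate on a zone edge (`|Re q_μ| = π`) the symbol has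
`Re σ(q) ≥ 15∕4 > 0` (b04∕b05's `re_DeltaXi_pos_of_edge` over the class). [folklore] -/
theorem SymbS.re_pos_of_edge (h : SymbS n σ r CS Cup) (hn : 1 ≤ n) {q : Fin d → ℂ} (hIm : ∀ ν, |(q ν).im| ≤ 2 * r)
    (μ : Fin d) (hμ : |(q μ).re| = Real.pi) : 0 < (σ q).re := by
  have hfl := h.floor (reVec q) (imVec q) hIm
  rw [cpt_reVec_imVec] at hfl
  have h2 : CS * ∑ ν, (imVec q) ν ^ 2 ≤ 1 / 4 := h.cs_sum_im_sq_le hIm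
  have h4 : 4 ≤ DeltaXir n 0 (reVec q) := by
    unfold DeltaXir
    rw [add_zero]
    have hnn : ∀ ν, 0 ≤ Sxir n ((reVec q) ν) := fun ν => Sxir_nonneg _ _
    have hsingle := Finset.single_le_sum (fun ν _ => hnn ν) (Finset.mem_univ μ)
    have h4' : 4 ≤ Sxir n ((reVec q) μ) := by
      rw [Sxir_eq]; exact four_le_scaled_sin_sq n hn hμ
    exact h4'.trans hsingle
  linarith

/-! ### §6 (c′) used: the bound of `ES` on the fat region -/

/-- `C_up ≥ 0` (the fat region contains the origin). [folklore] -/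
theorem SymbS.cup_nonneg (h : SymbS n σ r CS Cup) : 0 ≤ Cup := by
  have h0 : (fun _ : Fin d => (0 : ℂ)) ∈ Fat d r := fun ν => by
    simp only [Complex.zero_re, Complex.zero_im, abs_zero]
    exact ⟨by linarith [Real.pi_pos, h.r_pos], by linarith [h.r_pos]⟩
  exact (norm_nonneg _).trans (h.upper _ h0)

/-- the uniform bound `M_S = C_up + A·4^d + A·(C_up∕2)·132^d` of `ES` on the fat region (b04's `boundM` with `16d + m²₊ ↦ C_up`). [folklore] -/
def boundMS (d : ℕ) (A Cup : ℝ) : ℝ := Cup + A * 4 ^ d + A * (Cup / 2 * 132 ^ d)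

/-- `M_S ≥ 0`. [folklore] -/
theorem boundMS_nonneg (d : ℕ) {A Cup : ℝ} (hA : 0 ≤ A) (hC : 0 ≤ Cup) : 0 ≤ boundMS d A Cup := by
  unfold boundMS; positivity

/-- `M_S` is monotone in the coupling bound. [folklore] -/
theorem boundMS_mono (d : ℕ) {A A' Cup : ℝ} (hA' : A ≤ A') (hC : 0 ≤ Cup) : boundMS d A Cup ≤ boundMS d A' Cup := by
  unfold boundMS
  have h1 : (0:ℝ) ≤ 4 ^ d := by positivity
  have h2 : (0:ℝ) ≤ Cup / 2 * 132 ^ d := by positivity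
  nlinarith [mul_le_mul_of_nonneg_right hA' h1, mul_le_mul_of_nonneg_right hA' h2]

/-- (c′) USED: **`‖ES n σ a q‖ ≤ M_S(d, |a|, C_up)` on the fat region**, every `n ≥ 1` (b04's `norm_E_le` over the class). [folklore] -/
theorem SymbS.norm_ES_le [NeZero n] (h : SymbS n σ r CS Cup) (a : ℝ) {q : Fin d → ℂ} (hq : q ∈ Fat d r) :
    ‖ES n σ a q‖ ≤ boundMS d |a| Cup := by
  have hD : ‖σ q‖ ≤ Cup := h.upper q hq
  have hD0 : 0 ≤ Cup := h.cup_nonneg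
  have hU0 := norm_U_zero_le n h.r_le hq
  have hterm : ∀ k ∈ (Finset.univ.erase (fun _ => (0 : Fin n))),
      ‖U n k q * (σ q / σ (shift n k q))‖ ≤ ‖U n k q‖ * (Cup / 2) := by
    intro k hk
    have hk0 : k ≠ fun _ => 0 := Finset.ne_of_mem_erase hk
    have h2 : 2 ≤ ‖σ (shift n k q)‖ := h.two_le_norm_shift hq k hk0
    rw [norm_mul, norm_div]
    apply mul_le_mul_of_nonneg_left _ (norm_nonneg _)
    rw [div_le_div_iff₀ (by linarith) (by norm_num)]
    nlinarith [norm_nonneg (σ q)]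
  have hsum : ‖∑ k ∈ Finset.univ.erase (fun _ => (0 : Fin n)), U n k q * (σ q / σ (shift n k q))‖
      ≤ 132 ^ d * (Cup / 2) := by
    calc ‖∑ k ∈ Finset.univ.erase (fun _ => (0 : Fin n)), U n k q * (σ q / σ (shift n k q))‖
        ≤ ∑ k ∈ Finset.univ.erase (fun _ => (0 : Fin n)), ‖U n k q * (σ q / σ (shift n k q))‖ := norm_sum_le _ _
      _ ≤ ∑ k ∈ Finset.univ.erase (fun _ => (0 : Fin n)), ‖U n k q‖ * (Cup / 2) := Finset.sum_le_sum hterm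
      _ ≤ ∑ k : Fin d → Fin n, ‖U n k q‖ * (Cup / 2) :=
          Finset.sum_le_sum_of_subset_of_nonneg (Finset.erase_subset _ _) (fun k _ _ => by positivity)
      _ = (∑ k : Fin d → Fin n, ‖U n k q‖) * (Cup / 2) := by rw [Finset.sum_mul]
      _ ≤ 132 ^ d * (Cup / 2) := by gcongr; exact sum_norm_U_le n h.r_le hq
  unfold ES
  calc ‖σ q + (a : ℂ) * U n (fun _ => (0 : Fin n)) q +
        (a : ℂ) * ∑ k ∈ Finset.univ.erase (fun _ => (0 : Fin n)), U n k q * (σ q / σ (shift n k q))‖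
      ≤ ‖σ q‖ + ‖(a : ℂ) * U n (fun _ => (0 : Fin n)) q‖ +
        ‖(a : ℂ) * ∑ k ∈ Finset.univ.erase (fun _ => (0 : Fin n)), U n k q * (σ q / σ (shift n k q))‖ :=
        norm_add₃_le
    _ ≤ Cup + |a| * 4 ^ d + |a| * (Cup / 2 * 132 ^ d) := by
        rw [norm_mul, norm_mul, Complex.norm_real, Real.norm_eq_abs]
        gcongr
        linarith
    _ = boundMS d |a| Cup := rfl

/-! ### §7 (e′) used: holomorphy of `ES` on the fat region -/

/-- `q + 2πk` as a translate. [folklore] -/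
theorem shift_eq_add (n : ℕ) (k : Fin d → Fin n) :
    (shift n k : (Fin d → ℂ) → Fin d → ℂ) = fun p => p + fun μ => (2 * Real.pi * ((k μ : ℕ) : ℂ)) := by
  funext p μ; simp [shift]

/-- the shifted symbol `p ↦ σ(p + 2πk)` is holomorphic at every tube point. [folklore] -/
theorem SymbS.differentiableAt_shift (h : SymbS n σ r CS Cup) {q : Fin d → ℂ} (hq : ∀ ν, |(q ν).im| ≤ 2 * r)
    (k : Fin d → Fin n) : DifferentiableAt ℂ (fun p => σ (shift n k p)) q := by
  have him : ∀ ν, |(shift n k q ν).im| ≤ 2 * r := fun ν => by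
    simp only [shift, Complex.add_im, Complex.mul_im, Complex.re_ofNat, Complex.im_ofNat, Complex.ofReal_re,
      Complex.ofReal_im, Complex.natCast_re, Complex.natCast_im, mul_zero, zero_mul, add_zero, Complex.mul_re, sub_zero]
    exact hq ν
  have hσ := h.holo (shift n k q) him
  have hlin : DifferentiableAt ℂ (shift n k : (Fin d → ℂ) → Fin d → ℂ) q := by
    rw [shift_eq_add]; exact differentiableAt_id.add_const _
  exact hσ.comp q hlin

/-- (e′) USED: **`ES n σ a` is holomorphic (jointly) at every point of the fat region** (b05's `differentiableAt_E` over the class: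
(S2) at `q` and at `q + 2πk`, b04's `differentiableAt_U`, §4's non-vanishing). [folklore] -/
theorem SymbS.differentiableAt_ES [NeZero n] (h : SymbS n σ r CS Cup) (a : ℝ) {q : Fin d → ℂ} (hq : q ∈ Fat d r) :
    DifferentiableAt ℂ (ES n σ a) q := by
  have him : ∀ ν, |(q ν).im| ≤ 2 * r := fun ν => (hq ν).2
  have hσ : DifferentiableAt ℂ σ q := h.holo q him
  have hU : ∀ k : Fin d → Fin n, DifferentiableAt ℂ (fun p : Fin d → ℂ => U n k p) q :=
    fun k => differentiableAt_U n h.r_le hq k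
  have hsh : ∀ k : Fin d → Fin n, DifferentiableAt ℂ (fun p => σ (shift n k p)) q :=
    fun k => h.differentiableAt_shift him k
  have hne : ∀ k ∈ Finset.univ.erase (fun _ => (0 : Fin n)), σ (shift n k q) ≠ 0 :=
    fun k hk => h.shift_ne_zero hq k (Finset.ne_of_mem_erase hk)
  show DifferentiableAt ℂ (fun p => ES n σ a p) q
  simp only [ES]
  apply DifferentiableAt.fun_add
  · exact DifferentiableAt.fun_add hσ ((hU _).const_mul _)
  · apply DifferentiableAt.const_mul
    apply DifferentiableAt.fun_sum
    intro k hk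
    exact (hU k).fun_mul (dAt_div hσ (hsh k) (hne k hk))

/-- (e′) USED, slice form (hypothesis shape of b04's `imLipschitz_of_fat`): every coordinate slice of `ES` through a fat point
is holomorphic there. [folklore] -/
theorem SymbS.differentiableAt_ES_slice [NeZero n] (h : SymbS n σ r CS Cup) (a : ℝ) {q : Fin d → ℂ} (hq : q ∈ Fat d r)
    (μ : Fin d) : DifferentiableAt ℂ (fun w => ES n σ a (Function.update q μ w)) (q μ) := by
  have h1 : DifferentiableAt ℂ (ES n σ a) (Function.update q μ (q μ)) := by
    rw [Function.update_eq_self]; exact h.differentiableAt_ES a hq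
  exact h1.comp (q μ) (differentiableAt_update q μ (q μ))

end Summit.QuantumFields.BalabanUV.T4Continuum.NE7K1LinStripClass

end
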